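import Literature.Geometry.Riemannian.SurgicalRicciFlowBridge
import Literature.Geometry.Riemannian.SurgicalSolutions
import Literature.Topology.FourManifolds.CerfPropositionFour
import HarnessLib

/-!
# Hamilton's Cor. 1.2(a) (`hamilton_pic_sphere_four`) from Chen–Zhu's structure theorem and Cerf's theorem

The named fact `Literature.Geometry.Riemannian.hamilton_pic_sphere_four` (`PICSphereFacts.lean`;
R. Hamilton, Comm. Anal. Geom. 5 (1997), Cor. 1.2(a), p. 3: a compact simply connected
four-manifold with a metric of positive isotropic curvature is diffeomorphic to `S⁴`) has exactly
one published proof — the Ricci flow with surgery (Hamilton 1997 §§2–5, completed by Chen–Zhu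
2006 on Perelman's techniques) followed by the topological reconstruction of the manifold from the
pieces. The tree holds the topological half as theorems:

* `cerf_pi0Diff_sphere_three_of_relBoundary` (`CerfPropositionFour.lean`): Cerf's
  `π₀ Diff(D³ rel ∂) = 0` (`cerf_pi0DiffDisc_relBoundary_three`) gives `π₀ Diff⁺ S³ = 0` in the
  tree's form `cerf_pi0Diff_sphere_three` [cite: CerfDiffeoSphere1968, Ch. I §2];
* `hamilton_pic_sphere_four_of_chenZhu_of_cerf` (`SurgicalRicciFlowBridge.lean`): the structure
  statement of Chen–Zhu's Thm. 1.1 (`∃ m, ChenZhuResolvableIn m M g₀` for every closed simply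
  connected PIC `(M, g₀)`, `SurgicalRicciFlow.lean`: the outcome of the Ricci flow with surgery)
  and `Γ₄ = 0` give Cor. 1.2(a), through the neck-surgery shadow of Hamilton's programme
  (`HamiltonSurgeryProgramme.lean`) [cite: Hamilton1997, §1.1 pp. 3–4].

This file composes them: `hamilton_pic_sphere_four` follows from the structure statement of
Thm. 1.1 (the analysis: Chen–Zhu 2006, Thm. 1.1, in print "a direct consequence of" their
long-time existence theorem Thm. 5.6, p. 43) and the leaf named fact
`cerf_pi0DiffDisc_relBoundary_three` (Cerf 1968).

**Status of the structure statement (review of the decomposition, 2026-08-15, D-0026/D-0027).**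
Thm. 1.1's structure statement was vended as a named fact `chenZhu_ricciFlowWithSurgery`, a
decomposition child of Hamilton's Cor. 1.2(a). That child is *equivalent to its parent* modulo
short-time existence of the Ricci flow and Cerf's theorem
(`chenZhuResolvable_iff_hamilton_chen_tang_zhu`, `ChenZhuStructureFromClassification.lean`: with
`m = 0` surgeries, clause (iv) being purely topological), so it carried no proof burden of its
own and has been merged back into `hamilton_chen_tang_zhu`; here it is an explicit hypothesis.
A discharge of `hamilton_pic_sphere_four` (equivalently `hamilton_chen_tang_zhu`,
`PICSphereFactsProofs.lean`) is exactly a formal proof of the Ricci flow with surgery: its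
analytic path in the tree is `chenZhu_ricciFlowWithSurgery_of_step` (`SurgicalSolutionsCount.lean`,
Thm. 5.6 from the base of Chen–Zhu's induction and the surgery step, then Thm. 1.1) followed by
`hamilton_pic_sphere_four_of_chenZhu_of_cerfRelBoundary` below.

## References

* R. S. Hamilton, *Four-manifolds with positive isotropic curvature*, Comm. Anal. Geom. 5 (1997)
  1–92, Thm. 1.1 (p. 2), Cor. 1.2(a) (p. 3), §1.1 pp. 3–4. [Hamilton1997]
* B.-L. Chen, X.-P. Zhu, *Ricci flow with surgery on four-manifolds with positive isotropic
  curvature*, J. Differential Geom. 74 (2006) 177–264 (arXiv:math/0504478), Thm. 1.1 (p. 3),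
  Thm. 5.6 (p. 43). [ChenZhu2006]
* J. Cerf, *Sur les difféomorphismes de la sphère de dimension trois (Γ₄ = 0)*, Lecture Notes in
  Mathematics 53, Springer 1968, Ch. I §§1–2. [CerfDiffeoSphere1968]
-/

open scoped Manifold ContDiff

namespace Literature.Geometry.Riemannian

open Literature.Topology.FourManifolds

/-- **Hamilton's Cor. 1.2(a) from the structure theorem and Cerf's theorem.**
`hamilton_pic_sphere_four` follows from the structure statement of Chen–Zhu's Thm. 1.1 (a simply
connected closed PIC 4-manifold is resolved by a Ricci flow with finitely many surgeries,
`ChenZhuResolvableIn`) and Cerf's theorem `π₀ Diff(D³ rel ∂) = 0`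
(`cerf_pi0DiffDisc_relBoundary_three`), by composing the proved reductions
`cerf_pi0Diff_sphere_three_of_relBoundary` ((2) ⇒ Théorème 1) and
`hamilton_pic_sphere_four_of_chenZhu_of_cerf` (Thm. 1.1 + `Γ₄ = 0` ⇒ Cor. 1.2(a)).
[cite: Hamilton1997, Cor. 1.2(a) (p. 3)] [cite: ChenZhu2006, Thm. 1.1 (p. 3)]
[cite: CerfDiffeoSphere1968, Ch. I §2] -/
theorem hamilton_pic_sphere_four_of_chenZhu_of_cerfRelBoundary
    (hCZ : ∀ (M : Type) [TopologicalSpace M] [T2Space M] [SecondCountableTopology M]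
        [CompactSpace M] [ChartedSpace (EuclideanSpace ℝ (Fin 4)) M] [IsManifold (𝓡 4) ∞ M]
        [SimplyConnectedSpace M]
        (g₀ : Literature.Geometry.Lorentzian.PseudoRiemannianMetric (𝓡 4) ∞
          (EuclideanSpace ℝ (Fin 4)) (TangentSpace (𝓡 4) : M → Type _)),
        g₀.IsRiemannian → g₀.HasPositiveIsotropicCurvature → ∃ m : ℕ, ChenZhuResolvableIn m M g₀)
    (hcerf : cerf_pi0DiffDisc_relBoundary_three) : hamilton_pic_sphere_four :=
  hamilton_pic_sphere_four_of_chenZhu_of_cerf hCZ (cerf_pi0Diff_sphere_three_of_relBoundary hcerf)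

/-- **The remaining debt of `hamilton_pic_sphere_four` in this tree**: the fact is implied by the
conjunction of the structure statement of Chen–Zhu's Thm. 1.1 and Cerf's theorem (the converse
holds too, modulo short-time existence: `ChenZhuStructureFromClassification.lean`).
[cite: Hamilton1997, Cor. 1.2(a) (p. 3)] -/
theorem hamilton_pic_sphere_four_of_leaves
    (h : (∀ (M : Type) [TopologicalSpace M] [T2Space M] [SecondCountableTopology M]
         [CompactSpace M] [ChartedSpace (EuclideanSpace ℝ (Fin 4)) M] [IsManifold (𝓡 4) ∞ M]
         [SimplyConnectedSpace M]
         (g₀ : Literature.Geometry.Lorentzian.PseudoRiemannianMetric (𝓡 4) ∞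
           (EuclideanSpace ℝ (Fin 4)) (TangentSpace (𝓡 4) : M → Type _)),
         g₀.IsRiemannian → g₀.HasPositiveIsotropicCurvature → ∃ m : ℕ, ChenZhuResolvableIn m M g₀) ∧
      cerf_pi0DiffDisc_relBoundary_three) :
    hamilton_pic_sphere_four :=
  hamilton_pic_sphere_four_of_chenZhu_of_cerfRelBoundary h.1 h.2

end Literature.Geometry.Riemannian
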